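import Literature.Probability.RandomPlanarGeometry.CritPercSLESwallowingProofs
import Literature.Probability.RandomPlanarGeometry.SLEMomentSupersolution
import HarnessLib

/-!
# All moments `a < 1 - κ/8` of Rohde–Schramm's derivative ratio are bounded, uniformly in `z`

Topic `Probability/RandomPlanarGeometry`. Stochastic layer of the almost-sure upper bound
`dim_H γ[0,∞) ≤ 1 + κ/8` for the SLE_κ trace (Rohde–Schramm, *Basic properties of SLE*, Ann. of
Math. 161 (2005), Thm 8.1 / Cor 8.2), through **Lemma 6.3**: for `0 < κ < 8`, `z ∈ ℍ` and
`a < 1 - κ/8`, `E[Z(z)^a] = Ĝ_{a,κ}(z)/Ĝ_{a,κ}(1) < ∞` — in particular `sup_z E[Z(z)^a] < ∞`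
(`Ĝ` is bounded). Here `Z(z) = lim_{t↑τ(z)} ψₜ`, `ψₜ = (Im z)|gₜ'(z)|/Im gₜ(z)`.

We run the Itô calculus of the printed proof (p. 904: "`Mₜ := (ŷ|gₜ'(ẑ)|/yₜ)^a Ĝ(zₜ)` is a local
martingale") for a **general** moment exponent `a ≥ 0` and a **general** `C²` profile `G` in place
of `Ĝ`, exactly as `SLEDerivRatioItoProcess.lean` / `SLEDerivRatioObservable.lean` do for the one
pair `(rsSuperExp κ, rsSuperG κ)` (whose statements are the special case, not re-proved here):

* `momObs a G = G(w) ψ^a` (everything stopped at the localizing time `ρₙ` of `SLEPointFlow.lean`),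
  its semimartingale decomposition `ae_momObs_eq` (product rule + Itô's formula for `G(w)`, all Itô
  integrals of bounded integrands, hence martingales), and its drift
  `momObsDrift = (ψ^a/Y²) · D_{a,κ}G(w)` before `ρₙ` (`momObsDrift_eq_of_le`; `D_{a,κ} = rsDriftOp`,
  the generator computation of p. 904), `0` after;
* if `D_{a,κ} G ≤ 0` and `G ≥ 1`: `E[ψ^a_{t∧ρₙ}] ≤ E[M_t] ≤ M_0 = G(re z/im z)`
  (`integral_slePointRatioPow_le_apply_of_supersolution`);
* with the elementary supersolutions of `SLEMomentSupersolution.lean`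
  (`exists_supersolution_rsDriftOp`): **for `0 < κ < 8` and `0 ≤ a < 1 - κ/8` there is `C` with
  `E[ψ^a_{t∧ρₙ}(z)] ≤ C` for all `z ∈ ℍ`, `n`, `t`** (`exists_integral_slePointRatioPow_le`), and, by
  monotone convergence along `ρₙ ↑ τ(z)`, **`E[sup_{t<τ(z)} ψₜ(z)^a] ≤ C`** in the form
  `lintegral_iSup_slePointRatioPow_le` — Rohde–Schramm's `E[Z(z)^a] ≤ sup Ĝ/Ĝ(1)` for the full
  printed range of finite moments, uniformly in `z`.

What is NOT here: the exact value of the moments, their divergence for `a ≥ 1 - κ/8`, and the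
passage to `dist(z, γ)` (Koebe, (6.2)) — see `SLEOnePointEstimate.lean`.

## References

* S. Rohde, O. Schramm, *Basic properties of SLE*, Ann. of Math. 161 (2005), Lemma 6.3 and its
  proof (pp. 903–906), Thm 8.1 (p. 914).
* D. Revuz, M. Yor, *Continuous Martingales and Brownian Motion* (1999), Ch. IV, Prop. (3.1),
  Thm (3.3); Ch. II (supermartingales).
-/

noncomputable section

open Set Filter MeasureTheory Metric Complex
open _root_.Topology
open scoped NNReal ENNReal

namespace Literature.Probability.RandomPlanarGeometry

open Loewner Literature.Probability.Process Literature.Analysis.FunctionSpaces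

variable (κ : ℝ≥0) (z : ℂ) (n : ℕ) (a : ℝ) (G : ℝ → ℝ)

/-! ### The processes -/

/-- The Itô drift `b_w G'(w) + ½ σ_w² G''(w)` of `G(w)` along the stopped slope `w = X/Y`, for a
general profile `G`. [folklore] -/
def momGDrift (t : ℝ≥0) (ω : ℝ≥0 → ℝ) : ℝ :=
  slePointSlopeDrift κ z n t ω * deriv G (slePointSlope κ z n t ω) +
    2⁻¹ * slePointSlopeDiffusion κ z n t ω ^ 2 * iteratedDeriv 2 G (slePointSlope κ z n t ω)

/-- The diffusion coefficient `σ_w G'(w)` of `G(w)`. [folklore] -/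
def momGDiffusion (t : ℝ≥0) (ω : ℝ≥0 → ℝ) : ℝ :=
  slePointSlopeDiffusion κ z n t ω * deriv G (slePointSlope κ z n t ω)

/-- The rate `a · 𝟙 rate · ψ^a` of the finite-variation factor `ψ^a`. [folklore] -/
def momRatioPowRate (t : ℝ≥0) (ω : ℝ≥0 → ℝ) : ℝ :=
  a * slePointRatioRate κ z n t ω * slePointRatioPow κ z n a t ω

/-- **The observable `M = G(w) · ψ^a`** (Rohde–Schramm's `Mₜ = (ŷ|gₜ'(ẑ)|/yₜ)^a Ĝ(zₜ)` with a
general profile `G` in place of `Ĝ`, stopped at `ρₙ`). [cite: RohdeSchramm2005, Lemma 6.3 (proof)] -/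
def momObs (t : ℝ≥0) (ω : ℝ≥0 → ℝ) : ℝ :=
  G (slePointSlope κ z n t ω) * slePointRatioPow κ z n a t ω

/-- The drift `G(w) · (a 𝟙rate ψ^a) + ψ^a · (b_w G' + ½σ_w² G'')` of the observable (product rule).
[folklore] -/
def momObsDrift (t : ℝ≥0) (ω : ℝ≥0 → ℝ) : ℝ :=
  G (slePointSlope κ z n t ω) * momRatioPowRate κ z n a t ω +
    slePointRatioPow κ z n a t ω * momGDrift κ z n G t ω

/-- The diffusion coefficient `σ_w G'(w) ψ^a` of the observable. [folklore] -/
def momObsDiffusion (t : ℝ≥0) (ω : ℝ≥0 → ℝ) : ℝ :=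
  momGDiffusion κ z n G t ω * slePointRatioPow κ z n a t ω

variable {κ z n a G}

/-! ### `G(w)` is an Itô process (Itô's formula), for a general `C²` profile -/

/-- Bounds for `G`, `G'`, `G''` on the range of the slope: there is `C` with `|G(w_t)|, |G'(w_t)|,
|G''(w_t)| ≤ C` for all `t, ω` (continuity on the compact interval containing the bounded slope).
[folklore] -/
theorem exists_bound_derivs_comp_slePointSlope (hG : ContDiff ℝ 2 G) (hz : 0 < z.im) :
    ∃ C : ℝ, 0 ≤ C ∧ ∀ t ω, |G (slePointSlope κ z n t ω)| ≤ C ∧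
      |deriv G (slePointSlope κ z n t ω)| ≤ C ∧ |iteratedDeriv 2 G (slePointSlope κ z n t ω)| ≤ C := by
  set R : ℝ := (|z.re| + (n + 1) * ((n + 2) / z.im) + (n + 1)) * ((n + 2) / z.im) with hR
  have hf0 : Continuous G := hG.continuous
  have hf1 : Continuous (deriv G) := hG.continuous_deriv (by norm_num)
  have hf2 : Continuous (iteratedDeriv 2 G) := hG.continuous_iteratedDeriv 2 le_rfl
  obtain ⟨C0, hC0⟩ := isCompact_Icc.exists_bound_of_continuousOn (hf0.continuousOn (s := Icc (-R) R))
  obtain ⟨C1, hC1⟩ := isCompact_Icc.exists_bound_of_continuousOn (hf1.continuousOn (s := Icc (-R) R))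
  obtain ⟨C2, hC2⟩ := isCompact_Icc.exists_bound_of_continuousOn (hf2.continuousOn (s := Icc (-R) R))
  have hmem : ∀ t ω, slePointSlope κ z n t ω ∈ Icc (-R) R := fun t ω ↦
    abs_le.1 (abs_slePointSlope_le hz t ω)
  refine ⟨max (max C0 (max C1 C2)) 0, le_max_right _ _, fun t ω ↦ ⟨?_, ?_, ?_⟩⟩
  · have := hC0 _ (hmem t ω)
    rw [Real.norm_eq_abs] at this
    exact this.trans ((le_max_left _ _).trans (le_max_left _ _))
  · have := hC1 _ (hmem t ω)
    rw [Real.norm_eq_abs] at this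
    exact this.trans (((le_max_left _ _).trans (le_max_right _ _)).trans (le_max_left _ _))
  · have := hC2 _ (hmem t ω)
    rw [Real.norm_eq_abs] at this
    exact this.trans (((le_max_right _ _).trans (le_max_right _ _)).trans (le_max_left _ _))

/-- The diffusion coefficient `σ_w G'(w)` of `G(w)` is progressive. [folklore] -/
theorem isStronglyProgressive_momGDiffusion (hG : ContDiff ℝ 2 G) (κ : ℝ≥0) (hz : 0 < z.im) (n : ℕ) :
    IsStronglyProgressive brownianFiltration (momGDiffusion κ z n G) :=
  (isStronglyProgressive_slePointSlopeDiffusion κ hz n).mul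
    (IsStronglyProgressive.continuous_comp (isStronglyProgressive_slePointSlope κ hz n)
      (hG.continuous_deriv (by norm_num)))

/-- **`G(w)` is an Itô process** (Itô's formula for the `C²` function `G` along the slope): almost
surely, for all `t`, `G(w_t) = G(w_0) + ∫₀ᵗ (b_w G'(w) + ½σ_w² G''(w)) ds + K_t` with
`K = ∫ σ_w G'(w) dB` a martingale. [cite: RevuzYor1999, Ch. IV Thm (3.3) and Remark 1] -/
theorem isItoProcess_comp_slePointSlope (hG : ContDiff ℝ 2 G) (hz : 0 < z.im) :
    ∃ K : ℝ≥0 → (ℝ≥0 → ℝ) → ℝ,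
      IsItoIntegral (momGDiffusion κ z n G) brownian K brownianFiltration preWienerMeasure ∧
      Martingale K brownianFiltration preWienerMeasure ∧
      IsItoProcess (fun t ω ↦ G (slePointSlope κ z n t ω)) (momGDrift κ z n G)
        (momGDiffusion κ z n G) brownian brownianFiltration preWienerMeasure ∧
      ∀ᵐ ω ∂preWienerMeasure, ∀ t : ℝ≥0, G (slePointSlope κ z n t ω) =
        G (slePointSlope κ z n 0 ω) + timeIntegral (momGDrift κ z n G) t ω + K t ω := by
  obtain ⟨C, hC0, hC⟩ := exists_bound_derivs_comp_slePointSlope hG hz (κ := κ) (n := n)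
  have hσw := isStronglyProgressive_slePointSlopeDiffusion κ hz n
  have hprog := isStronglyProgressive_momGDiffusion hG κ hz n
  obtain ⟨K, hK, hKM, -⟩ := exists_isItoIntegral_of_abs_le hprog
    (C := Real.sqrt κ * ((n + 2) / z.im) * C) fun t ω ↦ by
      rw [momGDiffusion, abs_mul]
      exact mul_le_mul (abs_slePointSlopeDiffusion_le hz t ω) (hC t ω).2.1 (abs_nonneg _)
        (mul_nonneg (Real.sqrt_nonneg _) (div_nonneg (by positivity) hz.le))
  have hw := isItoProcess_slePointSlope hz (κ := κ) (n := n)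
  have hf : ContDiff ℝ 2 (Function.uncurry fun (_ : ℝ) (v : ℝ) ↦ G v) := hG.comp contDiff_snd
  have hwa : Adapted brownianFiltration (slePointSlope κ z n) := fun t ↦
    (stronglyAdapted_slePointSlope κ hz n t).measurable
  have hK' : IsItoIntegral (fun t ω ↦ slePointSlopeDiffusion κ z n t ω *
      deriv ((fun (_ : ℝ) (v : ℝ) ↦ G v) t) (slePointSlope κ z n t ω)) brownian K
      brownianFiltration preWienerMeasure := hK
  have hito := ito_formula_itoProcess_ae_holds (fun (_ : ℝ) (v : ℝ) ↦ G v) hf hwa hσw hw hK'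
  have hint := hw.ae_integrableOn_itoDrift hf hσw
  have hae : ∀ᵐ ω ∂preWienerMeasure, ∀ t : ℝ≥0, G (slePointSlope κ z n t ω) =
      G (slePointSlope κ z n 0 ω) + timeIntegral (momGDrift κ z n G) t ω + K t ω := by
    filter_upwards [hito] with ω hω t
    have h := hω t
    simp only [deriv_const, zero_add] at h
    rw [h]
    rfl
  refine ⟨K, hK, hKM, ⟨?_, K, hK, ?_⟩, hae⟩
  · filter_upwards [hint] with ω hω t
    have h := hω t
    simp only [deriv_const, zero_add] at h
    exact h
  · filter_upwards [hae] with ω hω t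
    rw [hω t]
    rfl

/-! ### The finite-variation factor `ψ^a` and the product rule -/

/-- `ψ^a` is bounded: `|ψ^a| ≤ exp(a · 4((n+2)/im z)²(n+1))` (`a ≥ 0`). [folklore] -/
theorem abs_slePointRatioPow_le_of_nonneg (ha : 0 ≤ a) (hz : 0 < z.im) (t : ℝ≥0) (ω : ℝ≥0 → ℝ) :
    |slePointRatioPow κ z n a t ω| ≤ Real.exp (a * (4 * ((n + 2) / z.im) ^ 2 * (n + 1))) := by
  obtain ⟨-, h2⟩ := slePointRatioPow_mem hz ha t ω (κ := κ) (n := n)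
  rw [abs_of_pos (slePointRatioPow_pos _ _ _)]
  exact h2

/-- The rate of `ψ^a` is locally integrable along every path. [folklore] -/
theorem integrableOn_momRatioPowRate (hz : 0 < z.im) (ω : ℝ≥0 → ℝ) (t : ℝ≥0) :
    IntegrableOn (fun s : ℝ ↦ momRatioPowRate κ z n a s.toNNReal ω) (Icc 0 t) := by
  have h : (fun s : ℝ ↦ momRatioPowRate κ z n a s.toNNReal ω) = fun s ↦
      trunc (slePointLocTime κ z n) (fun s ω ↦ a *
        (4 * slePointImStop κ z n s ω ^ 2 / slePointNormSqStop κ z n s ω ^ 2) *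
          slePointRatioPow κ z n a s ω) s.toNNReal ω := by
    funext s
    have := congrFun (congrFun (ratioPowRate_eq_trunc (κ := κ) (z := z) (n := n) a) s.toNNReal) ω
    simpa [momRatioPowRate] using this
  rw [h]
  refine integrableOn_trunc ?_
  have hc : Continuous fun s : ℝ≥0 ↦ a *
      (4 * slePointImStop κ z n s ω ^ 2 / slePointNormSqStop κ z n s ω ^ 2) *
        slePointRatioPow κ z n a s ω :=
    (continuous_const.mul (continuous_slePointRatioRate_untrunc hz ω)).mul
      (continuous_slePointRatioPow hz _ ω)
  exact (hc.comp continuous_real_toNNReal).continuousOn.integrableOn_compact isCompact_Icc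

/-- `ψ^a_t = ψ^a_0 + ∫₀ᵗ (rate of ψ^a) ds` (every `ω`, `t`; `ψ^a_0 = 1`). [folklore] -/
theorem slePointRatioPow_eq_zero_add' (hz : 0 < z.im) (ω : ℝ≥0 → ℝ) (t : ℝ≥0) :
    slePointRatioPow κ z n a t ω = slePointRatioPow κ z n a 0 ω +
      ∫ s in (0 : ℝ)..t, momRatioPowRate κ z n a s.toNNReal ω := by
  have h0 : slePointRatioPow κ z n a 0 ω = 1 := by
    simp [slePointRatioPow, timeIntegral_apply_zero]
  rw [h0, slePointRatioPow_eq_one_add hz]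
  rfl

/-- The diffusion coefficient `σ_w G'(w) ψ^a` of the observable is progressive. [folklore] -/
theorem isStronglyProgressive_momObsDiffusion (hG : ContDiff ℝ 2 G) (κ : ℝ≥0) (hz : 0 < z.im)
    (n : ℕ) (a : ℝ) : IsStronglyProgressive brownianFiltration (momObsDiffusion κ z n a G) :=
  (isStronglyProgressive_momGDiffusion hG κ hz n).mul (isStronglyProgressive_slePointRatioPow κ hz n _)

/-- **Semimartingale decomposition of the observable** (product rule
`d(G(w) ψ^a) = G(w) d(ψ^a) + ψ^a dG(w)`): almost surely, for all `t`,
`M_t = M_0 + ∫₀ᵗ D_s ds + K_t`, where `D = momObsDrift` and `K = ∫ σ_w G'(w) ψ^a dB` is a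
martingale. [cite: RohdeSchramm2005, Lemma 6.3 (proof)] -/
theorem ae_momObs_eq (hG : ContDiff ℝ 2 G) (ha : 0 ≤ a) (hz : 0 < z.im) :
    ∃ K : ℝ≥0 → (ℝ≥0 → ℝ) → ℝ,
      IsItoIntegral (momObsDiffusion κ z n a G) brownian K brownianFiltration preWienerMeasure ∧
      Martingale K brownianFiltration preWienerMeasure ∧
      ∀ᵐ ω ∂preWienerMeasure, ∀ t : ℝ≥0, momObs κ z n a G t ω =
        momObs κ z n a G 0 ω + timeIntegral (momObsDrift κ z n a G) t ω + K t ω := by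
  obtain ⟨C, hC0, hC⟩ := exists_bound_derivs_comp_slePointSlope hG hz (κ := κ) (n := n)
  obtain ⟨KN, hKN, hKNM, hN, -⟩ := isItoProcess_comp_slePointSlope hG hz (κ := κ) (n := n)
  have hσN := isStronglyProgressive_momGDiffusion hG κ hz n
  have hNprog : IsStronglyProgressive brownianFiltration fun t ω ↦ G (slePointSlope κ z n t ω) :=
    IsStronglyProgressive.continuous_comp (isStronglyProgressive_slePointSlope κ hz n) hG.continuous
  have hEprog := isStronglyProgressive_slePointRatioPow κ hz n a
  have hσNbd : ∀ t ω, |momGDiffusion κ z n G t ω| ≤ Real.sqrt κ * ((n + 2) / z.im) * C := fun t ω ↦ by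
    rw [momGDiffusion, abs_mul]
    exact mul_le_mul (abs_slePointSlopeDiffusion_le hz t ω) (hC t ω).2.1 (abs_nonneg _)
      (mul_nonneg (Real.sqrt_nonneg _) (div_nonneg (by positivity) hz.le))
  have hGbd : ∀ t ω, |G (slePointSlope κ z n t ω)| ≤ C := fun t ω ↦ (hC t ω).1
  -- Itô integrals of `σ_N · N` and `σ_N · ψ^a`
  obtain ⟨KX, hKX, hKXM, -⟩ := exists_isItoIntegral_of_abs_le (hσN.mul hNprog)
    (C := Real.sqrt κ * ((n + 2) / z.im) * C * C) fun t ω ↦ by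
      rw [abs_mul]
      exact mul_le_mul (hσNbd t ω) (hGbd t ω) (abs_nonneg _) (by positivity)
  obtain ⟨K, hK, hKM, -⟩ := exists_isItoIntegral_of_abs_le (hσN.mul hEprog)
    (C := Real.sqrt κ * ((n + 2) / z.im) * C *
      Real.exp (a * (4 * ((n + 2) / z.im) ^ 2 * (n + 1)))) fun t ω ↦ by
      rw [abs_mul]
      exact mul_le_mul (hσNbd t ω) (abs_slePointRatioPow_le_of_nonneg ha hz t ω) (abs_nonneg _)
        (by positivity)
  have hNa : StronglyAdapted brownianFiltration fun t ω ↦ G (slePointSlope κ z n t ω) :=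
    fun t ↦ hG.continuous.comp_stronglyMeasurable (stronglyAdapted_slePointSlope κ hz n t)
  have hNc : ∀ ω, Continuous fun t ↦ G (slePointSlope κ z n t ω) := fun ω ↦
    hG.continuous.comp (continuous_slePointSlope hz ω)
  have hmul := ae_mul_eq_of_isItoProcess hNa hNc hσN hN (stronglyAdapted_slePointRatioPow κ hz n _)
    (continuous_slePointRatioPow hz _) (ae_of_all _ (slePointRatioPow_eq_zero_add' hz))
    (ae_of_all _ fun ω t ↦ integrableOn_momRatioPowRate hz ω t) hKX hKXM hK hKM
  refine ⟨K, hK, hKM, ?_⟩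
  filter_upwards [hmul] with ω hω t
  rw [momObs, momObs, hω t]
  rfl

/-! ### The drift is `(ψ^a/Y²) D_{a,κ}G(w)` -/

/-- **The drift before `ρₙ`**: for `s ≤ ρₙ`, `D_s = (ψ^a_s / Y_s²) · D_{a,κ}G(w_s)` with
`D_{a,κ} = rsDriftOp κ a` — the generator computation (`superObs_drift_algebra`).
[cite: RohdeSchramm2005, Lemma 6.3 (proof)] -/
theorem momObsDrift_eq_of_le (hz : 0 < z.im) {s : ℝ≥0} {ω : ℝ≥0 → ℝ}
    (hs : (s : WithTop ℝ≥0) ≤ slePointLocTime κ z n ω) :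
    momObsDrift κ z n a G s ω = slePointRatioPow κ z n a s ω /
      slePointImStop κ z n s ω ^ 2 * rsDriftOp κ a G (slePointSlope κ z n s ω) := by
  have hY := slePointImStop_pos hz s ω (κ := κ) (n := n)
  set X := slePointReStop κ z n s ω with hX
  set Y := slePointImStop κ z n s ω with hYdef
  set E := slePointRatioPow κ z n a s ω with hE
  have hQeq : slePointNormSqStop κ z n s ω = X ^ 2 + Y ^ 2 := rfl
  have hw : slePointSlope κ z n s ω = X / Y := by rw [slePointSlope, slePointInvIm, div_eq_mul_inv]
  rw [hw]
  simp only [momObsDrift, momRatioPowRate, momGDrift, slePointSlopeDrift,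
    slePointSlopeDiffusion, slePointInvIm, slePointRatioRate, slePointInvImRate, slePointReDrift,
    slePointDiffusion, trunc_of_le hs, rsDriftOp, hw, hQeq, ← hX, ← hYdef, ← hE]
  exact superObs_drift_algebra hY.ne' (Real.sq_sqrt κ.coe_nonneg)

/-- **The drift is non-positive** when `D_{a,κ} G ≤ 0`: before `ρₙ` by `momObsDrift_eq_of_le`;
after `ρₙ` all truncated coefficients vanish and the drift is `0`.
[cite: RohdeSchramm2005, Lemma 6.3 (proof)] -/
theorem momObsDrift_nonpos (hD : ∀ w, rsDriftOp κ a G w ≤ 0) (hz : 0 < z.im) (s : ℝ≥0)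
    (ω : ℝ≥0 → ℝ) : momObsDrift κ z n a G s ω ≤ 0 := by
  by_cases hs : (s : WithTop ℝ≥0) ≤ slePointLocTime κ z n ω
  · rw [momObsDrift_eq_of_le hz hs]
    exact mul_nonpos_of_nonneg_of_nonpos
      (div_nonneg (slePointRatioPow_pos _ _ _).le (sq_nonneg _)) (hD _)
  · simp only [momObsDrift, momRatioPowRate, momGDrift, slePointSlopeDrift,
      slePointSlopeDiffusion, slePointRatioRate, slePointInvImRate, slePointReDrift,
      slePointDiffusion, trunc_of_not_le hs]
    simp

/-- The time integral of the drift is non-positive. [folklore] -/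
theorem timeIntegral_momObsDrift_nonpos (hD : ∀ w, rsDriftOp κ a G w ≤ 0) (hz : 0 < z.im)
    (t : ℝ≥0) (ω : ℝ≥0 → ℝ) : timeIntegral (momObsDrift κ z n a G) t ω ≤ 0 := by
  rw [timeIntegral, intervalIntegral.integral_of_le t.coe_nonneg]
  exact setIntegral_nonpos measurableSet_Ioc fun s _ ↦ momObsDrift_nonpos hD hz _ _

/-! ### Expectations -/

/-- The observable is bounded: `0 ≤ M ≤ B exp(a · 4((n+2)/im z)²(n+1))` if `1 ≤ G ≤ B`, `a ≥ 0`.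
[folklore] -/
theorem momObs_mem (hG1 : ∀ w, 1 ≤ G w) {B : ℝ} (hGB : ∀ w, G w ≤ B) (ha : 0 ≤ a) (hz : 0 < z.im)
    (t : ℝ≥0) (ω : ℝ≥0 → ℝ) :
    momObs κ z n a G t ω ∈ Icc (0 : ℝ) (B * Real.exp (a * (4 * ((n + 2) / z.im) ^ 2 * (n + 1)))) := by
  obtain ⟨h1, h2⟩ := slePointRatioPow_mem hz ha t ω (κ := κ) (n := n)
  have hG1' := hG1 (slePointSlope κ z n t ω)
  have hG2 := hGB (slePointSlope κ z n t ω)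
  refine ⟨mul_nonneg (zero_le_one.trans hG1') (zero_le_one.trans h1), ?_⟩
  exact mul_le_mul hG2 h2 (zero_le_one.trans h1) (zero_le_one.trans (hG1'.trans hG2))

/-- `ψ^a ≤ M` (`G ≥ 1`). [folklore] -/
theorem slePointRatioPow_le_momObs (hG1 : ∀ w, 1 ≤ G w) (t : ℝ≥0) (ω : ℝ≥0 → ℝ) :
    slePointRatioPow κ z n a t ω ≤ momObs κ z n a G t ω := by
  rw [momObs]
  exact le_mul_of_one_le_left (slePointRatioPow_pos _ _ _).le (hG1 _)

/-- `M_0 = G(re z / im z)`. [folklore] -/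
theorem momObs_zero (hz : 0 < z.im) (ω : ℝ≥0 → ℝ) : momObs κ z n a G 0 ω = G (z.re / z.im) := by
  rw [momObs, slePointSlope_zero hz]
  simp [slePointRatioPow, timeIntegral_apply_zero]

/-- The observable is strongly measurable at each time (`G` continuous). [folklore] -/
theorem stronglyMeasurable_momObs (hGc : Continuous G) (κ : ℝ≥0) (hz : 0 < z.im) (n : ℕ) (a : ℝ)
    (t : ℝ≥0) : StronglyMeasurable (momObs κ z n a G t) := by
  have h1 : StronglyMeasurable fun ω ↦ G (slePointSlope κ z n t ω) :=
    (hGc.comp_stronglyMeasurable (stronglyAdapted_slePointSlope κ hz n t)).mono (brownianFiltration.le t)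
  have h2 : StronglyMeasurable (slePointRatioPow κ z n a t) :=
    (stronglyAdapted_slePointRatioPow κ hz n _ t).mono (brownianFiltration.le t)
  exact h1.mul h2

/-- The observable is integrable at each time (bounded and measurable). [folklore] -/
theorem integrable_momObs (hGc : Continuous G) (hG1 : ∀ w, 1 ≤ G w) {B : ℝ} (hGB : ∀ w, G w ≤ B)
    (ha : 0 ≤ a) (hz : 0 < z.im) (t : ℝ≥0) : Integrable (momObs κ z n a G t) preWienerMeasure := by
  haveI := isProbabilityMeasure_preWienerMeasure'
  refine Integrable.of_bound (stronglyMeasurable_momObs hGc κ hz n a t).aestronglyMeasurable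
    (B * Real.exp (a * (4 * ((n + 2) / z.im) ^ 2 * (n + 1)))) (ae_of_all _ fun ω ↦ ?_)
  obtain ⟨h0, h1⟩ := momObs_mem hG1 hGB ha hz t ω (κ := κ) (n := n)
  rw [Real.norm_eq_abs, abs_of_nonneg h0]
  exact h1

/-- `ψ^a_{t∧ρₙ}` is integrable (`a ≥ 0`). [folklore] -/
theorem integrable_slePointRatioPow (ha : 0 ≤ a) (hz : 0 < z.im) (t : ℝ≥0) :
    Integrable (slePointRatioPow κ z n a t) preWienerMeasure := by
  haveI := isProbabilityMeasure_preWienerMeasure'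
  refine Integrable.of_bound ((stronglyAdapted_slePointRatioPow κ hz n _ t).mono
    (brownianFiltration.le t)).aestronglyMeasurable
    (Real.exp (a * (4 * ((n + 2) / z.im) ^ 2 * (n + 1)))) (ae_of_all _ fun ω ↦ ?_)
  rw [Real.norm_eq_abs]
  exact abs_slePointRatioPow_le_of_nonneg ha hz t ω

/-- **`E[M_t] ≤ M_0 = G(re z/im z)`** for a `C²` supersolution `1 ≤ G ≤ B`, `D_{a,κ}G ≤ 0`,
`a ≥ 0`: the observable is a supermartingale in expectation (`M_t ≤ M_0 + K_t` a.s. with `K` a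
martingale vanishing at `0`). [cite: RohdeSchramm2005, Lemma 6.3 (proof)] -/
theorem integral_momObs_le (hG : ContDiff ℝ 2 G) (hG1 : ∀ w, 1 ≤ G w) {B : ℝ} (hGB : ∀ w, G w ≤ B)
    (hD : ∀ w, rsDriftOp κ a G w ≤ 0) (ha : 0 ≤ a) (hz : 0 < z.im) (t : ℝ≥0) :
    ∫ ω, momObs κ z n a G t ω ∂preWienerMeasure ≤ G (z.re / z.im) := by
  haveI := isProbabilityMeasure_preWienerMeasure'
  obtain ⟨K, hK, hKM, hae⟩ := ae_momObs_eq hG ha hz (κ := κ) (n := n)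
  have hKint : Integrable (K t) preWienerMeasure := hKM.integrable t
  have hK0 : ∫ ω, K t ω ∂preWienerMeasure = 0 := by
    have h := hKM.setIntegral_eq (bot_le : (0 : ℝ≥0) ≤ t) (MeasurableSet.univ : MeasurableSet[brownianFiltration 0] univ)
    rw [Measure.restrict_univ] at h
    rw [← h]
    simp [hK.apply_zero]
  have hle : ∀ᵐ ω ∂preWienerMeasure, momObs κ z n a G t ω ≤ G (z.re / z.im) + K t ω := by
    filter_upwards [hae] with ω hω
    rw [hω t, momObs_zero hz]
    linarith [timeIntegral_momObsDrift_nonpos hD hz t ω (n := n)]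
  calc ∫ ω, momObs κ z n a G t ω ∂preWienerMeasure
      ≤ ∫ ω, (G (z.re / z.im) + K t ω) ∂preWienerMeasure :=
        integral_mono_ae (integrable_momObs hG.continuous hG1 hGB ha hz t) ((integrable_const _).add hKint) hle
    _ = G (z.re / z.im) := by
        rw [integral_add (integrable_const _) hKint, integral_const, hK0]
        simp

/-- **`E[ψ^a_{t∧ρₙ}] ≤ G(re z/im z)`** for every `n`, `t`, given a `C²` supersolution `1 ≤ G ≤ B`
of `D_{a,κ} G ≤ 0` (`a ≥ 0`, `z ∈ ℍ`). [cite: RohdeSchramm2005, Lemma 6.3] -/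
theorem integral_slePointRatioPow_le_apply_of_supersolution (hG : ContDiff ℝ 2 G)
    (hG1 : ∀ w, 1 ≤ G w) {B : ℝ} (hGB : ∀ w, G w ≤ B) (hD : ∀ w, rsDriftOp κ a G w ≤ 0) (ha : 0 ≤ a)
    (hz : 0 < z.im) (n : ℕ) (t : ℝ≥0) :
    ∫ ω, slePointRatioPow κ z n a t ω ∂preWienerMeasure ≤ G (z.re / z.im) :=
  calc ∫ ω, slePointRatioPow κ z n a t ω ∂preWienerMeasure
      ≤ ∫ ω, momObs κ z n a G t ω ∂preWienerMeasure :=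
        integral_mono (integrable_slePointRatioPow ha hz t) (integrable_momObs hG.continuous hG1 hGB ha hz t)
          fun ω ↦ slePointRatioPow_le_momObs hG1 t ω
    _ ≤ G (z.re / z.im) := integral_momObs_le hG hG1 hGB hD ha hz t

/-- **All moments `a < 1 - κ/8` are bounded, uniformly in `z ∈ ℍ`**: for `0 < κ < 8` and
`0 ≤ a < 1 - κ/8` there is `C` (`= 1 + D + E` of the elementary supersolution of
`SLEMomentSupersolution.lean`) with `E[ψ^a_{t∧ρₙ}(z)] ≤ C` for all `z ∈ ℍ`, `n`, `t` — the
finiteness half of Rohde–Schramm's Lemma 6.3 (`E[Z(z)^a] = Ĝ(z)/Ĝ(1) ≤ sup Ĝ/Ĝ(1)`) in the full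
printed range of exponents. [cite: RohdeSchramm2005, Lemma 6.3] -/
theorem exists_integral_slePointRatioPow_le {κ : ℝ≥0} (hκ0 : 0 < κ) {a : ℝ} (ha : 0 ≤ a)
    (ha8 : a < 1 - (κ : ℝ) / 8) :
    ∃ C : ℝ, ∀ {z : ℂ}, 0 < z.im → ∀ (n : ℕ) (t : ℝ≥0),
      ∫ ω, slePointRatioPow κ z n a t ω ∂preWienerMeasure ≤ C := by
  obtain ⟨G, M, hG, hG1, hGM, hD⟩ :=
    exists_supersolution_rsDriftOp (κ := (κ : ℝ)) (by exact_mod_cast hκ0) ha ha8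
  exact ⟨M, fun hz n t ↦ (integral_slePointRatioPow_le_apply_of_supersolution hG hG1 hGM hD ha hz n t).trans
    (hGM _)⟩

/-! ### The supremum over `[0, τ(z))`: `E[sup ψ^a] ≤ C` -/

/-- The sequence **`Ψₙ = ψ^a_{ρₙ}`** (the stopped power at time `n+1 ≥ ρₙ`) as an `ℝ≥0∞`-valued
random variable; its supremum over `n` dominates `ψₜ^a` for every `t < τ(z)`
(`ofReal_derivRatio_rpow_le_iSup`). [folklore] -/
def slePointRatioPowSeq (κ : ℝ≥0) (z : ℂ) (a : ℝ) (n : ℕ) (ω : ℝ≥0 → ℝ) : ℝ≥0∞ :=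
  ENNReal.ofReal (slePointRatioPow κ z n a ((n : ℝ≥0) + 1) ω)

/-- `Ψₙ` is measurable. [folklore] -/
theorem measurable_slePointRatioPowSeq (κ : ℝ≥0) {z : ℂ} (hz : 0 < z.im) (a : ℝ) (n : ℕ) :
    Measurable (slePointRatioPowSeq κ z a n) :=
  (measurable_slePointRatioPow_succ κ hz a n).ennreal_ofReal

/-- `supₙ Ψₙ` is measurable. [folklore] -/
theorem measurable_iSup_slePointRatioPowSeq (κ : ℝ≥0) {z : ℂ} (hz : 0 < z.im) (a : ℝ) :
    Measurable fun ω ↦ ⨆ n, slePointRatioPowSeq κ z a n ω :=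
  Measurable.iSup fun n ↦ measurable_slePointRatioPowSeq κ hz a n

/-- `Ψₙ = ofReal (ψ(ρₙ)^a)` in terms of Rohde–Schramm's ratio at the time `ρₙ`. [folklore] -/
theorem slePointRatioPowSeq_eq (hz : 0 < z.im) (a : ℝ) (n : ℕ) (ω : ℝ≥0 → ℝ) :
    slePointRatioPowSeq κ z a n ω =
      ENNReal.ofReal (derivRatio (sleDriving κ ω) z ((slePointLocTime κ z n ω).untopA) ^ a) := by
  rw [slePointRatioPowSeq, slePointRatioPow_succ_eq hz]

/-- **`ψₜ^a ≤ supₙ Ψₙ` for every `t < τ(z)`** (`a ≥ 0`): `t ≤ ρ_N` for some `N`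
(`exists_le_slePointLocTime`) and `ψ` is non-decreasing before `τ(z)` ((6.3)).
[cite: RohdeSchramm2005, eq. (6.3)] -/
theorem ofReal_derivRatio_rpow_le_iSup (hz : 0 < z.im) {a : ℝ} (ha : 0 ≤ a) (ω : ℝ≥0 → ℝ)
    {t : ℝ≥0} (ht : (t : WithTop ℝ≥0) < swallowingTime (sleDriving κ ω) z) :
    ENNReal.ofReal (derivRatio (sleDriving κ ω) z t ^ a) ≤ ⨆ n, slePointRatioPowSeq κ z a n ω := by
  obtain ⟨N, hN⟩ := exists_le_slePointLocTime hz ω ht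
  have htρ : t ≤ (slePointLocTime κ z N ω).untopA := by
    rw [← WithTop.coe_le_coe, coe_untopA_slePointLocTime]
    exact hN N le_rfl
  refine le_trans ?_ (le_iSup (fun n ↦ slePointRatioPowSeq κ z a n ω) N)
  rw [slePointRatioPowSeq_eq hz]
  refine ENNReal.ofReal_le_ofReal (Real.rpow_le_rpow ?_ ?_ ha)
  · exact zero_le_one.trans (one_le_derivRatio (continuous_sleDriving κ ω) hz ht)
  · refine derivRatio_mono (continuous_sleDriving κ ω) hz htρ ?_
    rw [coe_untopA_slePointLocTime]
    exact slePointLocTime_lt_swallowingTime hz N ω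

/-- **`E[supₙ Ψₙ] ≤ C`** whenever `E[ψ^a_{t∧ρₙ}] ≤ C` for all `n`, `t` (`a ≥ 0`): `Ψₙ` is
non-decreasing in `n` (`ρₙ ↑`, `ψ ↑`), so monotone convergence applies. [folklore] -/
theorem lintegral_iSup_slePointRatioPowSeq_le (hz : 0 < z.im) {a : ℝ} (ha : 0 ≤ a) {C : ℝ}
    (hC : ∀ (n : ℕ) (t : ℝ≥0), ∫ ω, slePointRatioPow κ z n a t ω ∂preWienerMeasure ≤ C) :
    ∫⁻ ω, ⨆ n, slePointRatioPowSeq κ z a n ω ∂preWienerMeasure ≤ ENNReal.ofReal C := by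
  have hFm : ∀ n, Measurable (slePointRatioPowSeq κ z a n) := fun n ↦
    measurable_slePointRatioPowSeq κ hz a n
  have hFmono : Monotone fun n ↦ slePointRatioPowSeq κ z a n := fun m k hmk ω ↦
    ENNReal.ofReal_le_ofReal (monotone_slePointRatioPow_succ hz ha ω hmk)
  rw [lintegral_iSup hFm hFmono]
  refine iSup_le fun n ↦ ?_
  have hint : Integrable (slePointRatioPow κ z n a ((n : ℝ≥0) + 1)) preWienerMeasure :=
    integrable_slePointRatioPow ha hz _
  have heq : ∫⁻ ω, slePointRatioPowSeq κ z a n ω ∂preWienerMeasure =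
      ENNReal.ofReal (∫ ω, slePointRatioPow κ z n a ((n : ℝ≥0) + 1) ω ∂preWienerMeasure) := by
    rw [ofReal_integral_eq_lintegral_ofReal hint (ae_of_all _ fun ω ↦ (slePointRatioPow_pos _ _ _).le)]
    rfl
  rw [heq]
  exact ENNReal.ofReal_le_ofReal (hC n _)

/-- **Rohde–Schramm's Lemma 6.3, all moments, uniformly in `z`**: for `0 < κ < 8` and
`0 ≤ a < 1 - κ/8` there is `C < ∞` such that for every `z ∈ ℍ` the measurable random variable
`S = supₙ Ψₙ` — which dominates `ψₜ(z)^a` for all `t < τ(z)`, hence `Z(z)^a`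
(`ofReal_derivRatio_rpow_le_iSup`) — has `E[S] ≤ C`. [cite: RohdeSchramm2005, Lemma 6.3] -/
theorem lintegral_iSup_slePointRatioPow_le {κ : ℝ≥0} (hκ0 : 0 < κ) {a : ℝ} (ha : 0 ≤ a)
    (ha8 : a < 1 - (κ : ℝ) / 8) :
    ∃ C : ℝ≥0, ∀ {z : ℂ}, 0 < z.im →
      ∫⁻ ω, ⨆ n, slePointRatioPowSeq κ z a n ω ∂preWienerMeasure ≤ C := by
  obtain ⟨C, hC⟩ := exists_integral_slePointRatioPow_le hκ0 ha ha8
  refine ⟨C.toNNReal, fun hz ↦ ?_⟩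
  have h := lintegral_iSup_slePointRatioPowSeq_le hz ha (fun n t ↦ hC hz n t) (κ := κ)
  simpa only [ENNReal.ofReal] using h

end Literature.Probability.RandomPlanarGeometry
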